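/-
Origin: expansion seat `planner-pub-hodgecm-pv14-g6-0`, handover none (imports Mathlib only) ; any order (independent leaf) (`HOME/pub-hodgecm-pv14-g6/lean/Pv14g6/SchwartzBoundedConvergence.lean`, md5 011e5e17, 194 lines);
landed by the gen-8 packager in gate run 30 as `HodgeCM/Automorphic/SchwartzBoundedConvergence.lean` (verbatim).
-/
/-
Copyright (c) 2026. All rights reserved.
Released under Apache 2.0 license as described in the file LICENSE.
Origin: pub-hodgecm-pv14-g6 (DAG-node prover #14, gen 6), file #15; target
`HodgeCM/Automorphic/SchwartzBoundedConvergence.lean` (namespace `HodgeCM.SchwartzWeil`).  NEW ADDITIVE LEAF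
(imports Mathlib only).
-/
import Mathlib.Analysis.Distribution.SchwartzSpace.Basic
import Mathlib.Analysis.Calculus.MeanValue

/-!
# On Schwartz-bounded sets, uniform convergence is Schwartz convergence

The engine behind every "Fréchet-smooth vector" statement ([SETUP D5′] of the campaign): to prove that a net
`f i → g` in the **Schwartz topology** of `𝓢(E, F)` it suffices to prove

* (boundedness) every Schwartz seminorm of `f i` is eventually bounded, and
* (uniform convergence) `f i → g` uniformly on `E` (i.e. in the single seminorm `p₀,₀`).

The proof is an interpolation argument, no compactness: the **Landau-type inequality**
`‖Dg(x)‖ ≤ 2ε/h + C h` for a function with `‖g‖ ≤ ε` whose derivative is `C`-Lipschitz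
(`norm_fderiv_le_of_norm_le_of_lipschitz`) upgrades uniform smallness of `D^n (f i)` to uniform smallness of
`D^{n+1} (f i)` given a bound on `D^{n+2} (f i)` (`eventually_norm_iteratedFDeriv_le`), and the weights `‖x‖^k`
are traded against one more power of decay (`tendsto_zero_of_seminorm_bounded_of_uniform`).

Main statements: `tendsto_zero_of_seminorm_bounded_of_uniform`, `tendsto_of_seminorm_bounded_of_uniform`.
-/

noncomputable section

open scoped SchwartzMap Topology
open Filter Set Metric

namespace HodgeCM
namespace SchwartzWeil

variable {E F G : Type*} [NormedAddCommGroup E] [NormedSpace ℝ E] [NormedAddCommGroup F] [NormedSpace ℝ F]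
  [NormedAddCommGroup G] [NormedSpace ℝ G]

/-! ## The Landau-type interpolation inequality -/

/-- First-order Taylor estimate with a Lipschitz derivative: `‖Dg(x) w‖ ≤ ‖g (x + w)‖ + ‖g x‖ + C ‖w‖²`. -/
theorem norm_fderiv_apply_le_of_lipschitz {g : E → G} (hg : Differentiable ℝ g) {C : ℝ} (hC : 0 ≤ C) (x : E)
    (hlip : ∀ y, ‖fderiv ℝ g y - fderiv ℝ g x‖ ≤ C * ‖y - x‖) (w : E) :
    ‖fderiv ℝ g x w‖ ≤ ‖g (x + w)‖ + ‖g x‖ + C * ‖w‖ ^ 2 := by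
  have hconv : Convex ℝ (closedBall x ‖w‖) := convex_closedBall x ‖w‖
  have hx : x ∈ closedBall x ‖w‖ := mem_closedBall_self (norm_nonneg w)
  have hy : x + w ∈ closedBall x ‖w‖ := by simp [mem_closedBall, dist_eq_norm]
  have hT : ‖g (x + w) - g x - fderiv ℝ g x (x + w - x)‖ ≤ C * ‖w‖ * ‖x + w - x‖ :=
    hconv.norm_image_sub_le_of_norm_fderiv_le' (fun y _ => hg y)
      (fun y hy' => (hlip y).trans (mul_le_mul_of_nonneg_left
        (by simpa [mem_closedBall, dist_eq_norm] using hy') hC)) hx hy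
  simp only [add_sub_cancel_left] at hT
  have h1 : ‖fderiv ℝ g x w‖ ≤ ‖g (x + w) - g x‖ + ‖g (x + w) - g x - fderiv ℝ g x w‖ := by
    have := norm_sub_le (g (x + w) - g x) (g (x + w) - g x - fderiv ℝ g x w)
    simpa using this
  have h2 : ‖g (x + w) - g x‖ ≤ ‖g (x + w)‖ + ‖g x‖ := norm_sub_le _ _
  nlinarith [h1, h2, hT]

/-- **Landau-type inequality.**  If `‖g‖ ≤ ε` everywhere and `Dg` is `C`-Lipschitz around `x`, then
`‖Dg(x)‖ ≤ 2ε/h + C h` for every `h > 0`. -/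
theorem norm_fderiv_le_of_norm_le_of_lipschitz {g : E → G} (hg : Differentiable ℝ g) {ε C : ℝ} (hC : 0 ≤ C)
    (hε : ∀ y, ‖g y‖ ≤ ε) (x : E) (hlip : ∀ y, ‖fderiv ℝ g y - fderiv ℝ g x‖ ≤ C * ‖y - x‖)
    {h : ℝ} (hh : 0 < h) : ‖fderiv ℝ g x‖ ≤ 2 * ε / h + C * h := by
  have hε0 : 0 ≤ ε := (norm_nonneg _).trans (hε x)
  refine ContinuousLinearMap.opNorm_le_bound _ (by positivity) fun v => ?_
  by_cases hv : v = 0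
  · simp [hv]
  have hvpos : 0 < ‖v‖ := norm_pos_iff.2 hv
  -- apply the Taylor estimate to `w := (h / ‖v‖) • v`, a vector of norm `h`
  have key := norm_fderiv_apply_le_of_lipschitz hg hC x hlip ((h / ‖v‖) • v)
  have hnw : ‖(h / ‖v‖) • v‖ = h := by
    rw [norm_smul, Real.norm_of_nonneg (by positivity)]; field_simp
  rw [map_smul, norm_smul, Real.norm_of_nonneg (by positivity), hnw] at key
  have key' : h / ‖v‖ * ‖fderiv ℝ g x v‖ ≤ 2 * ε + C * h ^ 2 := by
    linarith [hε (x + (h / ‖v‖) • v), hε x]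
  rw [div_mul_eq_mul_div, div_le_iff₀ hvpos] at key'
  have : (2 * ε / h + C * h) * ‖v‖ = ((2 * ε + C * h ^ 2) * ‖v‖) / h := by
    field_simp
  rw [this, le_div_iff₀ hh]
  linarith

/-! ## From uniform smallness of `D^n f` to uniform smallness of `D^{n+1} f` -/

/-- The derivative of `x ↦ D^{n+1} f x` has norm `‖D^{n+2} f x‖`, whence `D^{n+1} f` is Lipschitz with the
uniform bound of `D^{n+2} f`. -/
theorem norm_iteratedFDeriv_succ_sub_le (f : 𝓢(E, F)) (n : ℕ) {C : ℝ}
    (hC : ∀ z, ‖iteratedFDeriv ℝ (n + 2) f z‖ ≤ C) (x y : E) :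
    ‖iteratedFDeriv ℝ (n + 1) f y - iteratedFDeriv ℝ (n + 1) f x‖ ≤ C * ‖y - x‖ := by
  have hd : Differentiable ℝ (iteratedFDeriv ℝ (n + 1) (f : E → F)) :=
    (f.smooth ((n + 1 : ℕ) + 1 : ℕ)).differentiable_iteratedFDeriv (by exact_mod_cast Nat.lt_succ_self _)
  exact convex_univ.norm_image_sub_le_of_norm_fderiv_le (fun z _ => hd z)
    (fun z _ => by rw [norm_fderiv_iteratedFDeriv]; exact hC z) (mem_univ x) (mem_univ y)

/-- The derivative of `D^n f` is `D^{n+1} f` read through the currying isometry; in particular it is Lipschitz with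
the uniform bound of `D^{n+2} f`. -/
theorem norm_fderiv_iteratedFDeriv_sub_le (f : 𝓢(E, F)) (n : ℕ) {C : ℝ}
    (hC : ∀ z, ‖iteratedFDeriv ℝ (n + 2) f z‖ ≤ C) (x y : E) :
    ‖fderiv ℝ (iteratedFDeriv ℝ n (f : E → F)) y - fderiv ℝ (iteratedFDeriv ℝ n (f : E → F)) x‖ ≤ C * ‖y - x‖ := by
  rw [fderiv_iteratedFDeriv]
  simp only [Function.comp_apply]
  rw [← LinearIsometryEquiv.map_sub, LinearIsometryEquiv.norm_map]
  exact norm_iteratedFDeriv_succ_sub_le f n hC x y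

/-- **Step A.**  If all `p₀,ₘ (f i)` are eventually bounded and `f i → 0` uniformly, then every derivative
`D^n (f i) → 0` uniformly. -/
theorem eventually_norm_iteratedFDeriv_le {ι : Type*} {l : Filter ι} {f : ι → 𝓢(E, F)}
    (hb : ∀ n : ℕ, ∃ C, ∀ᶠ i in l, SchwartzMap.seminorm ℝ 0 n (f i) ≤ C)
    (h0 : ∀ ε, 0 < ε → ∀ᶠ i in l, ∀ x, ‖f i x‖ ≤ ε) (n : ℕ) :
    ∀ ε, 0 < ε → ∀ᶠ i in l, ∀ x, ‖iteratedFDeriv ℝ n (f i) x‖ ≤ ε := by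
  induction n with
  | zero =>
    intro ε hε
    filter_upwards [h0 ε hε] with i hi x
    rw [norm_iteratedFDeriv_zero]
    exact hi x
  | succ n ih =>
    intro ε hε
    obtain ⟨C, hC⟩ := hb (n + 2)
    set C' : ℝ := max C 1 with hC'
    have hC'pos : 0 < C' := lt_of_lt_of_le one_pos (le_max_right _ _)
    set h : ℝ := ε / (2 * C') with hh
    have hhpos : 0 < h := by positivity
    filter_upwards [hC, ih (ε * h / 4) (by positivity)] with i hiC hiε x
    have hC2 : ∀ z, ‖iteratedFDeriv ℝ (n + 2) (f i) z‖ ≤ C' := fun z =>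
      ((SchwartzMap.norm_iteratedFDeriv_le_seminorm ℝ (f i) (n + 2) z).trans hiC).trans (le_max_left _ _)
    have hg : Differentiable ℝ (iteratedFDeriv ℝ n (f i : E → F)) :=
      ((f i).smooth ((n : ℕ) + 1 : ℕ)).differentiable_iteratedFDeriv (by exact_mod_cast Nat.lt_succ_self _)
    have := norm_fderiv_le_of_norm_le_of_lipschitz hg hC'pos.le hiε x
      (fun y => norm_fderiv_iteratedFDeriv_sub_le (f i) n hC2 x y) hhpos
    rw [norm_fderiv_iteratedFDeriv] at this
    refine this.trans (le_of_eq ?_)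
    rw [hh]; field_simp; ring

/-! ## The convergence criterion -/

/-- **On Schwartz-bounded sets, uniform convergence is Schwartz convergence** (null-net form): if every Schwartz
seminorm of `f i` is eventually bounded and `f i → 0` uniformly on `E`, then `f i → 0` in `𝓢(E, F)`. -/
theorem tendsto_zero_of_seminorm_bounded_of_uniform {ι : Type*} {l : Filter ι} {f : ι → 𝓢(E, F)}
    (hb : ∀ k n : ℕ, ∃ C, ∀ᶠ i in l, SchwartzMap.seminorm ℝ k n (f i) ≤ C)
    (h0 : ∀ ε, 0 < ε → ∀ᶠ i in l, ∀ x, ‖f i x‖ ≤ ε) : Tendsto f l (𝓝 0) := by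
  rw [(schwartz_withSeminorms ℝ E F).tendsto_nhds]
  rintro ⟨k, n⟩ ε hε
  obtain ⟨C, hC⟩ := hb (k + 1) n
  set M : ℝ := max C 0 with hM
  have hM0 : 0 ≤ M := le_max_right _ _
  set R : ℝ := max (2 * M / ε) 1 with hR
  have hRpos : 0 < R := lt_of_lt_of_le one_pos (le_max_right _ _)
  have hA := eventually_norm_iteratedFDeriv_le (fun m => hb 0 m) h0 n (ε / (4 * R ^ k)) (by positivity)
  filter_upwards [hC, hA] with i hiC hiA
  simp only [SchwartzMap.schwartzSeminormFamily_apply, sub_zero]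
  refine lt_of_le_of_lt (SchwartzMap.seminorm_le_bound ℝ k n (f i) (by positivity : (0 : ℝ) ≤ ε / 2)
    fun x => ?_) (by linarith)
  rcases le_or_gt ‖x‖ R with hx | hx
  · calc ‖x‖ ^ k * ‖iteratedFDeriv ℝ n (f i) x‖ ≤ R ^ k * (ε / (4 * R ^ k)) :=
          mul_le_mul (pow_le_pow_left₀ (norm_nonneg _) hx k) (hiA x) (norm_nonneg _) (by positivity)
      _ = ε / 4 := by field_simp
      _ ≤ ε / 2 := by linarith
  · have hxpos : 0 < ‖x‖ := hRpos.trans hx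
    have h1 : ‖x‖ ^ (k + 1) * ‖iteratedFDeriv ℝ n (f i) x‖ ≤ M :=
      ((SchwartzMap.le_seminorm ℝ (k + 1) n (f i) x).trans hiC).trans (le_max_left _ _)
    have h2 : 2 * M ≤ R * ε := by
      have : 2 * M / ε ≤ R := le_max_left _ _
      rwa [div_le_iff₀ hε] at this
    calc ‖x‖ ^ k * ‖iteratedFDeriv ℝ n (f i) x‖
        = ‖x‖ ^ (k + 1) * ‖iteratedFDeriv ℝ n (f i) x‖ / ‖x‖ := by
          rw [pow_succ]; field_simp
      _ ≤ M / R := div_le_div₀ hM0 h1 hRpos hx.le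
      _ ≤ ε / 2 := by
          rw [div_le_iff₀ hRpos]
          linarith

/-- **On Schwartz-bounded sets, uniform convergence is Schwartz convergence.**  If every Schwartz seminorm of
`f i` is eventually bounded and `f i → g` uniformly on `E`, then `f i → g` in the Schwartz topology. -/
theorem tendsto_of_seminorm_bounded_of_uniform {ι : Type*} {l : Filter ι} {f : ι → 𝓢(E, F)} {g : 𝓢(E, F)}
    (hb : ∀ k n : ℕ, ∃ C, ∀ᶠ i in l, SchwartzMap.seminorm ℝ k n (f i) ≤ C)
    (h0 : ∀ ε, 0 < ε → ∀ᶠ i in l, ∀ x, ‖f i x - g x‖ ≤ ε) : Tendsto f l (𝓝 g) := by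
  rw [← tendsto_sub_nhds_zero_iff]
  refine tendsto_zero_of_seminorm_bounded_of_uniform (fun k n => ?_) (by simpa only [sub_apply] using h0)
  obtain ⟨C, hC⟩ := hb k n
  refine ⟨C + SchwartzMap.seminorm ℝ k n g, ?_⟩
  filter_upwards [hC] with i hi
  exact (map_sub_le_add _ _ _).trans (by linarith)

/-- The same criterion with the uniform convergence phrased through the seminorm `p₀,₀`. -/
theorem tendsto_of_seminorm_bounded_of_tendsto_seminorm_zero {ι : Type*} {l : Filter ι} {f : ι → 𝓢(E, F)}
    {g : 𝓢(E, F)} (hb : ∀ k n : ℕ, ∃ C, ∀ᶠ i in l, SchwartzMap.seminorm ℝ k n (f i) ≤ C)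
    (h0 : Tendsto (fun i => SchwartzMap.seminorm ℝ 0 0 (f i - g)) l (𝓝 0)) : Tendsto f l (𝓝 g) := by
  refine tendsto_of_seminorm_bounded_of_uniform hb fun ε hε => ?_
  filter_upwards [(tendsto_order.1 h0).2 ε hε] with i hi x
  exact ((SchwartzMap.norm_le_seminorm ℝ (f i - g) x).trans hi.le)

end SchwartzWeil
end HodgeCM
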